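import Mathlib
import HarnessLib
import Literature.Analysis.FluidPDE.VectorCalculus
import Literature.Analysis.FluidPDE.LerayHopfProofs
import Literature.Analysis.FluidPDE.AxisymHouLiVariables
import Summits.NavierStokesRegularity.NavierStokesRegularity.Theorems.PoloidalWindowDoorPoloidalWindowRigidityConstantShearMeans

/-!
# Theorem A on `ℝ³`: horizontal lifts `y ↦ g(Py + z e₂)` and their calculus

Seat ns-poloidal-K2-p2 g6 (interim lead-of-record on crux K2 `PoloidalWindowRigidity` = stmt-NavierStokesRegularity-19708;
line `mixed_type` v1; item stmt-20428 `LrcModEntire`).  Plumbing for the CLASS COROLLARY of Theorem A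
(`…ThmA.fderiv_eq_zero_of_sliceEquation`): we apply Theorem A on `E = ℝ³` itself (`dim = 3 < 4`) to the family

  `sliceFun g z : ℝ³ → ℝ`, `y ↦ g(P y + z e₂)`  (`P` = the horizontal projection `y ↦ y − y₂ e₂`),

i.e. the value of `g` on the horizontal plane of height `z`, extended constantly in `y₂`.  Recorded here (pure calculus,
`g : ℝ³ → ℝ` of class `C²`):
* `hproj`, `hlift` and their coordinates; `‖P‖ ≤ 1`;
* `fderiv_sliceFun_apply` — `D(sliceFun g z)(y) v = Dg(Py + z e₂)(P v)`;
* `norm_iteratedFDeriv_sliceFun_le` — `‖Dᵏ(sliceFun g z)(y)‖ ≤ ‖Dᵏg(Py + z e₂)‖`;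
* `divergence_gradient_sliceFun` — `div ∇ (sliceFun g z)(y) = (∂₀²g + ∂₁²g)(Py + z e₂)` (the horizontal Laplacian);
* `hasDerivAt_sliceFun_height` — `∂_z sliceFun g z y = ∂₂g(Py + z e₂)`.
WHAT THIS IS NOT: not a claim about Navier–Stokes — coordinate calculus (bears_on LADDER-NS N0 via crux K2 = stmt-19708 /
item 20428, mixed_type `stub_semiElliptic` ∩ (TH)).
-/

-- the summit and its single sub-problem share the name (CONVENTIONS §1)
set_option linter.dupNamespace false

noncomputable section

namespace Summit.NavierStokesRegularity.NavierStokesRegularity.Theorems.PoloidalWindowDoorPoloidalWindowRigidityThmASliceGeometry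

open Set Function Filter Topology InnerProductSpace
open scoped RealInnerProductSpace
open Literature.Analysis.FluidPDE
open Summit.NavierStokesRegularity.NavierStokesRegularity.Theorems.PoloidalWindowDoorPoloidalWindowRigidityConstantShearMeans

/-! ### The horizontal projection and the lift to height `z` -/

/-- The horizontal projection `P y = y − y₂ e₂`. -/
def hproj : EuclideanSpace ℝ (Fin 3) →L[ℝ] EuclideanSpace ℝ (Fin 3) :=
  ContinuousLinearMap.id ℝ _ - (EuclideanSpace.proj (2 : Fin 3)).smulRight (EuclideanSpace.single 2 (1 : ℝ))

/-- `P y = y − y₂ e₂`. -/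
theorem hproj_apply (y : EuclideanSpace ℝ (Fin 3)) : hproj y = y - (y 2) • EuclideanSpace.single 2 (1 : ℝ) := rfl

/-- Coordinates of `P y`: the vertical one vanishes. -/
theorem hproj_apply_two (y : EuclideanSpace ℝ (Fin 3)) : hproj y 2 = 0 := by
  simp [hproj_apply]

/-- Coordinates of `P y`: the horizontal ones are those of `y`. -/
theorem hproj_apply_of_ne (y : EuclideanSpace ℝ (Fin 3)) {i : Fin 3} (hi : i ≠ 2) : hproj y i = y i := by
  simp [hproj_apply, hi]

/-- `P e₂ = 0`. -/
theorem hproj_single_two : hproj (EuclideanSpace.single 2 (1 : ℝ)) = 0 := by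
  ext i
  by_cases hi : i = 2
  · subst hi; simp [hproj_apply]
  · simp [hproj_apply]

/-- `P e_b = e_b` for `b ≠ 2`. -/
theorem hproj_single_of_ne {b : Fin 3} (hb : b ≠ 2) :
    hproj (EuclideanSpace.single b (1 : ℝ)) = EuclideanSpace.single b (1 : ℝ) := by
  simp [hproj_apply, hb]

/-- `‖P y‖ ≤ ‖y‖`. -/
theorem norm_hproj_le (y : EuclideanSpace ℝ (Fin 3)) : ‖hproj y‖ ≤ ‖y‖ := by
  rw [EuclideanSpace.norm_eq, EuclideanSpace.norm_eq]
  refine Real.sqrt_le_sqrt (Finset.sum_le_sum fun i _ => ?_)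
  by_cases hi : i = 2
  · subst hi; rw [hproj_apply_two]; simp [sq_nonneg]
  · rw [hproj_apply_of_ne y hi]

/-- `‖P‖ ≤ 1`. -/
theorem opNorm_hproj_le : ‖hproj‖ ≤ 1 :=
  ContinuousLinearMap.opNorm_le_bound _ zero_le_one fun y => by simpa using norm_hproj_le y

/-- The lift to height `z`: `A_z y = P y + z e₂`. -/
def hlift (z : ℝ) (y : EuclideanSpace ℝ (Fin 3)) : EuclideanSpace ℝ (Fin 3) :=
  hproj y + z • EuclideanSpace.single 2 (1 : ℝ)

/-- `(A_z y)₂ = z`. -/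
theorem hlift_apply_two (z : ℝ) (y : EuclideanSpace ℝ (Fin 3)) : hlift z y 2 = z := by
  simp [hlift, hproj_apply_two]

/-- `(A_z y)_b = y_b` for `b ≠ 2`. -/
theorem hlift_apply_of_ne (z : ℝ) (y : EuclideanSpace ℝ (Fin 3)) {i : Fin 3} (hi : i ≠ 2) : hlift z y i = y i := by
  simp [hlift, hproj_apply_of_ne y hi, hi]

/-- `A_z y = y` on the plane `y₂ = z`. -/
theorem hlift_of_eq {z : ℝ} {y : EuclideanSpace ℝ (Fin 3)} (hy : y 2 = z) : hlift z y = y := by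
  ext i
  by_cases hi : i = 2
  · subst hi; rw [hlift_apply_two, hy]
  · exact hlift_apply_of_ne z y hi

/-- `A_z y = P y + z e₂` written with the translation last. -/
theorem hlift_eq (z : ℝ) : hlift z = fun y => hproj y + z • EuclideanSpace.single 2 (1 : ℝ) := rfl

/-- `D A_z = P`. -/
theorem hasFDerivAt_hlift (z : ℝ) (y : EuclideanSpace ℝ (Fin 3)) : HasFDerivAt (hlift z) hproj y :=
  (hproj.hasFDerivAt).add_const _

/-- `∂_z A_z y = e₂`. -/
theorem hasDerivAt_hlift_height (y : EuclideanSpace ℝ (Fin 3)) (z : ℝ) :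
    HasDerivAt (fun s => hlift s y) (EuclideanSpace.single 2 (1 : ℝ)) z := by
  unfold hlift
  have h := ((hasDerivAt_id z).smul_const (EuclideanSpace.single 2 (1 : ℝ))).const_add (hproj y)
  simpa using h

/-! ### The horizontal lift of a scalar function -/

/-- `sliceFun g z y = g(P y + z e₂)`: the restriction of `g` to the plane of height `z`, constant in `y₂`. -/
def sliceFun (g : EuclideanSpace ℝ (Fin 3) → ℝ) (z : ℝ) (y : EuclideanSpace ℝ (Fin 3)) : ℝ := g (hlift z y)

variable {g : EuclideanSpace ℝ (Fin 3) → ℝ}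

/-- `sliceFun g z` is `Cⁿ` if `g` is. -/
theorem contDiff_sliceFun {n : WithTop ℕ∞} (hg : ContDiff ℝ n g) (z : ℝ) : ContDiff ℝ n (sliceFun g z) :=
  hg.comp (hproj.contDiff.add contDiff_const)

/-- Chain rule: `D(sliceFun g z)(y) = Dg(A_z y) ∘ P`. -/
theorem hasFDerivAt_sliceFun (hg : Differentiable ℝ g) (z : ℝ) (y : EuclideanSpace ℝ (Fin 3)) :
    HasFDerivAt (sliceFun g z) ((fderiv ℝ g (hlift z y)).comp hproj) y :=
  (hg (hlift z y)).hasFDerivAt.comp y (hasFDerivAt_hlift z y)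

/-- `D(sliceFun g z)(y) v = Dg(A_z y)(P v)`. -/
theorem fderiv_sliceFun_apply (hg : Differentiable ℝ g) (z : ℝ) (y v : EuclideanSpace ℝ (Fin 3)) :
    fderiv ℝ (sliceFun g z) y v = fderiv ℝ g (hlift z y) (hproj v) := by
  rw [(hasFDerivAt_sliceFun hg z y).fderiv]
  rfl

/-- `∂_z sliceFun g z y = ∂₂ g (A_z y)`. -/
theorem hasDerivAt_sliceFun_height (hg : Differentiable ℝ g) (y : EuclideanSpace ℝ (Fin 3)) (z : ℝ) :
    HasDerivAt (fun s => sliceFun g s y) (fderiv ℝ g (hlift z y) (EuclideanSpace.single 2 (1 : ℝ))) z :=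
  (hg (hlift z y)).hasFDerivAt.comp_hasDerivAt z (hasDerivAt_hlift_height y z)

/-- `‖Dᵏ(sliceFun g z)(y)‖ ≤ ‖Dᵏ g(A_z y)‖` (`k ≤ n`, `g ∈ Cⁿ`; `‖P‖ ≤ 1`). -/
theorem norm_iteratedFDeriv_sliceFun_le {n : WithTop ℕ∞} (hg : ContDiff ℝ n g) (z : ℝ) (y : EuclideanSpace ℝ (Fin 3))
    {k : ℕ} (hk : (k : WithTop ℕ∞) ≤ n) :
    ‖iteratedFDeriv ℝ k (sliceFun g z) y‖ ≤ ‖iteratedFDeriv ℝ k g (hlift z y)‖ := by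
  have h1 : sliceFun g z = (fun x => g (x + z • EuclideanSpace.single 2 (1 : ℝ))) ∘ hproj := rfl
  have hg' : ContDiff ℝ n fun x => g (x + z • EuclideanSpace.single 2 (1 : ℝ)) :=
    hg.comp (contDiff_id.add contDiff_const)
  rw [h1, hproj.iteratedFDeriv_comp_right hg' y hk, iteratedFDeriv_comp_add_right]
  refine (ContinuousMultilinearMap.norm_compContinuousLinearMap_le _ _).trans ?_
  refine mul_le_of_le_one_right (norm_nonneg _) ?_
  exact Finset.prod_le_one (fun _ _ => norm_nonneg _) fun _ _ => opNorm_hproj_le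

/-! ### The horizontal Laplacian -/

/-- Coordinates of the gradient of the lift: `(∇ sliceFun g z (y))_i = Dg(A_z y)(P e_i)`. -/
theorem gradient_sliceFun_apply (hg : Differentiable ℝ g) (z : ℝ) (y : EuclideanSpace ℝ (Fin 3)) (i : Fin 3) :
    gradient (sliceFun g z) y i = fderiv ℝ g (hlift z y) (hproj (EuclideanSpace.single i (1 : ℝ))) := by
  have h : gradient (sliceFun g z) y i = ⟪EuclideanSpace.single i (1 : ℝ), gradient (sliceFun g z) y⟫ := by
    rw [EuclideanSpace.inner_single_left]; simp
  rw [h, inner_gradient_right_eq_fderiv, fderiv_sliceFun_apply hg]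

/-- **The Laplacian of the lift is the horizontal Laplacian**: `div ∇(sliceFun g z)(y) = ∂₀²g(A_z y) + ∂₁²g(A_z y)`
(`g ∈ C²`). [folklore] -/
theorem divergence_gradient_sliceFun (hg : ContDiff ℝ 2 g) (z : ℝ) (y : EuclideanSpace ℝ (Fin 3)) :
    VectorCalculus.divergence (gradient (sliceFun g z)) y =
      fderiv ℝ (fun x => fderiv ℝ g x (EuclideanSpace.single 0 (1 : ℝ))) (hlift z y) (EuclideanSpace.single 0 (1 : ℝ)) +
      fderiv ℝ (fun x => fderiv ℝ g x (EuclideanSpace.single 1 (1 : ℝ))) (hlift z y) (EuclideanSpace.single 1 (1 : ℝ)) := by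
  have hgd : Differentiable ℝ g := hg.differentiable (by norm_num)
  have hGd : ∀ w : EuclideanSpace ℝ (Fin 3), Differentiable ℝ fun x => fderiv ℝ g x w := fun w =>
    ((hg.fderiv_right (m := 1) (by norm_num)).clm_apply contDiff_const).differentiable one_ne_zero
  have hw2 : ContDiff ℝ 2 (sliceFun g z) := contDiff_sliceFun hg z
  have hV : Differentiable ℝ (gradient (sliceFun g z)) := by
    have : ContDiff ℝ 1 (gradient (sliceFun g z)) := by
      have h1 := hw2.fderiv_right (m := 1) (by norm_num)
      exact (InnerProductSpace.toDual ℝ (EuclideanSpace ℝ (Fin 3))).symm.contDiff.comp h1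
    exact this.differentiable one_ne_zero
  -- coordinates of the gradient as lifts of the partial derivatives
  have hcoord : ∀ i : Fin 3, (fun y => gradient (sliceFun g z) y i)
      = sliceFun (fun x => fderiv ℝ g x (hproj (EuclideanSpace.single i (1 : ℝ)))) z := by
    intro i; ext y; rw [gradient_sliceFun_apply hgd]; rfl
  rw [divergence_eq_sum_three]
  have hterm : ∀ i : Fin 3, fderiv ℝ (gradient (sliceFun g z)) y (EuclideanSpace.single i (1 : ℝ)) i
      = fderiv ℝ (fun x => fderiv ℝ g x (hproj (EuclideanSpace.single i (1 : ℝ)))) (hlift z y)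
          (hproj (EuclideanSpace.single i (1 : ℝ))) := by
    intro i
    rw [← fderiv_coord_apply (hV y), hcoord i, fderiv_sliceFun_apply (hGd _)]
  rw [hterm 0, hterm 1, hterm 2, hproj_single_of_ne (by decide : (0 : Fin 3) ≠ 2),
    hproj_single_of_ne (by decide : (1 : Fin 3) ≠ 2), hproj_single_two]
  simp

end Summit.NavierStokesRegularity.NavierStokesRegularity.Theorems.PoloidalWindowDoorPoloidalWindowRigidityThmASliceGeometry

end
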